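import Summits.BirchSwinnertonDyer.BirchSwinnertonDyer.Theses.CycTangentCM
import Literature.NumberTheory.EllipticCurves.DeShalit1987.SplitPrimeMuVanishingProofs
import HarnessLib

/-!
# `TwoVarUnitContent` (route `CycTangentCM`, item stmt-BirchSwinnertonDyer-22632) GRANTED ONLY the
# verbatim one-variable Gillard theorem on the split-prime line

Seat `prover-bsd-line-ctcm-p3` (D-0145 line `route-BirchSwinnertonDyer-CycTangentCM`, prover 3/3).
Companion of `Theorems/CycTangentCMTwoVarUnitContent.lean` (`twoVarUnitContent_of_thmIII212`: the
item modulo the TWO-variable transcription (G2) `DeShalit1987.thmIII212_exists_isUnit_coeff_katzMeasure₂`).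
With the line-restriction road now in the tree —
`DeShalit1987/KatzMeasureMonomialLines.lean` (restriction `curveSubst` to a formal curve through the
origin, its values, "unit coefficient of a line in degree `n` ⟹ unit coefficient `[T₁^iT₂^j]G` with
`i + j ≤ n`"), `…MonomialLinesPAdic.lean` (binomial series `(1+T)^c`, `p`-adic powers),
`…MonomialLinesFrames.lean` (avatar identity `ρ̂(σ) = (1+(ρ̂(γ)−1))^{κ(σ)}`, `IsKatzMeasure₂ ⟹
IsKatzBranch` along every sub-`ℤ_p`-line), `ZpExtensionSplitPrimeLineThroughPair.lean` (the split-prime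
`ℤ_p`-quotient through any generator pair, from the rank-one inertia theorem at a completely split `p`),
and `DeShalit1987/SplitPrimeMuVanishingProofs.lean` ((G1) ⟹ (G2) for twists of type `(k, 0)`) — the
item follows from the ONE-variable fact (G1) `DeShalit1987.thmIII212_hasUnitContent_katzBranch`
= Gillard 1985 Thm. 2.9 / de Shalit 1987 III.2.12 VERBATIM ("les coefficients de la série `g(T, v)` ne
sont pas tous dans l'idéal maximal"), read at the twist `ψ_A⁻¹` of type `(−1, 0)`:
`twoVarUnitContent_of_thmIII212_katzBranch (h) : TwoVarUnitContent`, CONDITIONAL on (G1) and on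
nothing else.  The item stays open on the ledger (closable only by a `_holds` of the fact); its trust
base is now the printed one-variable theorem.  BSD is not proved by any of this.

References: [Gillard1985] Thm. 2.9 (p. 87); [deShalit1987] III.1.11 (18), III.2.12 (p. 103), II.4.17
(51)–(54) (p. 77–78); [Schneps1987] Thm. IV.
-/

-- the summit namespace `Summit.BirchSwinnertonDyer.BirchSwinnertonDyer` repeats the problem name by design (D-0017)
set_option linter.dupNamespace false
set_option autoImplicit false

noncomputable section

open Literature.NumberTheory.GaloisRepresentations
open Literature.NumberTheory.EllipticCurves
open Literature.NumberTheory.EllipticCurves.GreenbergVatsal2000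

namespace Summit.BirchSwinnertonDyer.BirchSwinnertonDyer.Theorems

/-- **`TwoVarUnitContent` granted Gillard's one-variable theorem (G1) only.** For every CM anchor curve
`A/ℚ`, good ordinary `p ≥ 5` with `A[p]` irreducible, and every frame package `(K, ψ, ι, v, v̄, S, κ₁,
κ₂; γ₁, γ₂, Ω, δ, Ω_p, G)` of the katz-cyc-axis line, some coefficient `[T₁^i T₂^j]G` of the
`ψ⁻¹`-twisted two-variable Katz–de Shalit germ is a unit — from
`DeShalit1987.thmIII212_hasUnitContent_katzBranch.exists_isUnit_coeff_coeff` (the tree-level road: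
split-prime line through the pair, restriction of the frame, Gillard on the branch, lift) at the twist
`λ = ψ⁻¹` of type `(−1, 0)`, unramified off `S`.  CONDITIONAL on (G1) (hypothesis `h`); unconditional in
everything else. -/
theorem twoVarUnitContent_of_thmIII212_katzBranch
    (h : DeShalit1987.thmIII212_hasUnitContent_katzBranch) :
    Summit.BirchSwinnertonDyer.BirchSwinnertonDyer.Theses.CycTangentCM.TwoVarUnitContent := by
  intro A _ _ p _ hp hj _hgood _hord _hirr K _ _ hK ψ hψ _hL ι v vbar hv hvbar hne hι S hvS hvbarS
    _hSram hSunr κ₁ κ₂ γ₁ γ₂ hpair _hcyc _hγ₂ Ω δ Ωp hΩ hΩp hδ G hG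
  have hK' : IsImaginaryQuadratic K := ⟨hK.1, IsCMFieldOfJ.isTotallyComplex hj hK⟩
  have hψ' : ψ⁻¹.HasInfinityType (fun _ ↦ (-1 : ℤ)) (fun _ ↦ (0 : ℤ)) := by
    simpa [Pi.neg_def] using hψ.inv
  have hunr : ∀ w : IsDedekindDomain.HeightOneSpectrum (NumberField.RingOfIntegers K), w ∉ S →
      ψ⁻¹.IsUnramifiedAt w :=
    fun w hw ↦ (hSunr w hw).inv'
  exact DeShalit1987.thmIII212_hasUnitContent_katzBranch.exists_isUnit_coeff_coeff h p K hp hK' ι v vbar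
    hv hvbar hne hι S hvS hvbarS κ₁ κ₂ γ₁ γ₂ hpair ψ⁻¹ (-1) hψ' hunr Ω δ Ωp hΩ hΩp hδ G hG

end Summit.BirchSwinnertonDyer.BirchSwinnertonDyer.Theorems
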